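import Summits.SmoothPoincare4.SmoothPoincare4.Theses.EntropyRung
import Literature.Geometry.Riemannian.ChangGurskyYangProofs
import Literature.Geometry.Riemannian.QuotientMetric
import Literature.Geometry.Riemannian.ConstantCurvatureDescent
import Literature.Topology.FourManifolds.RealProjectiveSpaceProofs
import Literature.Topology.FourManifolds.SphereSimplyConnected

/-!
# `ChangGurskyYang` minus simple connectivity is false: the round `ℝℙ⁴` (negative lemma for crux stmt-SmoothPoincare4-10834)

Crux `EntropyRung.ChangGurskyYang` (= the named fact `changGurskyYang_sphere_four`, Chang–Gursky–Yang
2003 Thm. A, simply connected `scal > 0` case): a compact simply connected smooth `4`-manifold with a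
`C^∞` Riemannian metric of positive scalar curvature and Weyl energy `∫|W|² dV < 32π²` is
diffeomorphic to `S⁴`. This file records that `[SimplyConnectedSpace M]` IS LOAD-BEARING, even when
weakened to `[ConnectedSpace M]`: the round real projective space `ℝℙ⁴ = S⁴/±1` — the orbit space of
the antipodal action (tree `RealProjectiveSpaceProofs.lean`) with the quotient of the round metric
(tree `quotientMetric`, Lee 2018 Prop. 2.32) — is closed, connected, has constant curvature `1`
(descent along the local isometry `S⁴ → ℝℙ⁴`, tree `hasConstantSectionalCurvature_of_comap_of_surjective`),
hence `R ≡ 12 > 0` and `∫|W|² = 0 < 32π²`, and is NOT diffeomorphic to `S⁴` (`π₁(ℝℙ⁴) = ℤ₂`, tree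
`IsRealProjectiveSpace.not_simplyConnectedSpace`, versus `simplyConnectedSpace_euclideanSphere`). This is
exactly the second alternative "or `ℝP⁴`" of CGY's Theorem A. New here: the antipodal maps are
isometries of the round metric (`roundMetric_antipodal`). Refuter negative lemma (cdisprove gen 1);
supports the crux item. Everything proved.

## References

* S.-Y. A. Chang, M. J. Gursky, P. C. Yang, Publ. Math. IHÉS 98 (2003) 105–143, Thm. A. [ChangGurskyYang2003]
* J. M. Lee, *Introduction to Riemannian Manifolds* (2018), Prop. 2.32, Prop. 8.36. [Lee2018]
* A. Hatcher, *Algebraic Topology* (2002), Example 1.43. [HatcherAT2002]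
-/

noncomputable section

namespace Summit.SmoothPoincare4.SmoothPoincare4.Theorems.ChangGurskyYang.Negative

set_option linter.dupNamespace false

open scoped Manifold ContDiff Topology RealInnerProductSpace
open Literature.Geometry.Lorentzian Literature.Geometry.Lorentzian.PseudoRiemannianMetric
open Literature.Geometry.Riemannian Literature.Topology.FourManifolds
open Metric Module Function

/-- Local notation: the ambient `ℝ⁵` of the tree's `𝕊 4`. -/
local notation "V5" => EuclideanSpace ℝ (Fin (4 + 1))
/-- Local notation: the round `S⁴` with Mathlib's manifold structure. -/
local notation "S4" => (Metric.sphere (0 : EuclideanSpace ℝ (Fin (4 + 1))) 1)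
/-- Local notation: `ℝℙ⁴` as the orbit space of the antipodal action. -/
local notation "RP4" => MulAction.orbitRel.Quotient ℤˣ S4

/-- `dim ℝ⁵ = 4 + 1`, as a `Fact` for the sphere API. [folklore] -/
theorem factFinrankV5 : Fact (finrank ℝ V5 = 4 + 1) := ⟨finrank_euclideanSpace_fin⟩

attribute [local instance] factFinrankV5
attribute [local instance] antipodalAction
attribute [local instance] continuousConstSMul_antipodal isCancelSMul_antipodal

/-- **`x ↦ -x` is an isometry of the round metric** (`g_y(v,w) = ⟪dι v, dι w⟫` and
`dι_{-y} ∘ d(neg)_y = d(-ι)_y = -dι_y`). [cite: Lee2018, Prop. 2.32] -/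
theorem roundMetric_neg (y : S4) (v w : TangentSpace (𝓡 4) y) :
    (roundMetric (n := 4) V5).val (-y) (mfderiv (𝓡 4) (𝓡 4) (fun x : S4 ↦ -x) y v)
      (mfderiv (𝓡 4) (𝓡 4) (fun x : S4 ↦ -x) y w) = (roundMetric (n := 4) V5).val y v w := by
  rw [roundMetric_apply, roundMetric_apply]
  have hι : ContMDiff (𝓡 4) 𝓘(ℝ, V5) ∞ ((↑) : S4 → V5) := contMDiff_coe_sphere
  have hn : ContMDiff (𝓡 4) (𝓡 4) ∞ (fun x : S4 ↦ -x) := contMDiff_neg_sphere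
  have hcomp : HasMFDerivAt (𝓡 4) 𝓘(ℝ, V5) (((↑) : S4 → V5) ∘ fun x : S4 ↦ -x) y
      ((mfderiv (𝓡 4) 𝓘(ℝ, V5) ((↑) : S4 → V5) (-y)).comp
        (mfderiv (𝓡 4) (𝓡 4) (fun x : S4 ↦ -x) y)) :=
    HasMFDerivAt.comp y (hι.mdifferentiableAt (by simp)).hasMFDerivAt
      (hn.mdifferentiableAt (by simp)).hasMFDerivAt
  have hfun : (((↑) : S4 → V5) ∘ fun x : S4 ↦ -x) = -((↑) : S4 → V5) := by
    funext x; simp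
  rw [hfun] at hcomp
  have key : ∀ z : TangentSpace (𝓡 4) y,
      ((mfderiv (𝓡 4) 𝓘(ℝ, V5) ((↑) : S4 → V5) (-y)
          (mfderiv (𝓡 4) (𝓡 4) (fun x : S4 ↦ -x) y z) : V5)) =
        -((mfderiv (𝓡 4) 𝓘(ℝ, V5) ((↑) : S4 → V5) y z : V5)) := by
    intro z
    have h1 : mfderiv (𝓡 4) 𝓘(ℝ, V5) (-((↑) : S4 → V5)) y z =
        mfderiv (𝓡 4) 𝓘(ℝ, V5) ((↑) : S4 → V5) (-y)
          (mfderiv (𝓡 4) (𝓡 4) (fun x : S4 ↦ -x) y z) := by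
      rw [hcomp.mfderiv]; rfl
    have h2 : mfderiv (𝓡 4) 𝓘(ℝ, V5) (-((↑) : S4 → V5)) y z =
        -(mfderiv (𝓡 4) 𝓘(ℝ, V5) ((↑) : S4 → V5) y z) := by
      rw [mfderiv_neg]; rfl
    exact h1.symm.trans h2
  rw [key v, key w]
  exact @inner_neg_neg ℝ V5 _ _ _ _ _

/-- Transport of `roundMetric_neg` to any map equal to `x ↦ -x`. [folklore] -/
theorem roundMetric_inv_of_eq_neg {f : S4 → S4} (hf : f = fun x : S4 ↦ -x) (y : S4)
    (v w : TangentSpace (𝓡 4) y) :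
    (roundMetric (n := 4) V5).val (f y) (mfderiv (𝓡 4) (𝓡 4) f y v)
      (mfderiv (𝓡 4) (𝓡 4) f y w) = (roundMetric (n := 4) V5).val y v w := by
  subst hf
  exact roundMetric_neg y v w

/-- The identity is an isometry. [folklore] -/
theorem roundMetric_inv_of_eq_id {f : S4 → S4} (hf : f = id) (y : S4)
    (v w : TangentSpace (𝓡 4) y) :
    (roundMetric (n := 4) V5).val (f y) (mfderiv (𝓡 4) (𝓡 4) f y v)
      (mfderiv (𝓡 4) (𝓡 4) f y w) = (roundMetric (n := 4) V5).val y v w := by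
  subst hf
  rw [mfderiv_id]
  rfl

/-- **The antipodal action `{±1} ↷ S⁴` is isometric** for the round metric (hypothesis `hinv` of
the tree's `quotientMetric`). [cite: Lee2018, Prop. 2.32] -/
theorem roundMetric_antipodal (u : ℤˣ) (y : S4) (v w : TangentSpace (𝓡 4) y) :
    (roundMetric (n := 4) V5).val (u • y) (mfderiv (𝓡 4) (𝓡 4) (fun x : S4 ↦ u • x) y v)
      (mfderiv (𝓡 4) (𝓡 4) (fun x : S4 ↦ u • x) y w) = (roundMetric (n := 4) V5).val y v w := by
  rcases Int.units_eq_one_or u with rfl | rfl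
  · exact roundMetric_inv_of_eq_id (funext fun x ↦ one_smul ℤˣ x) y v w
  · exact roundMetric_inv_of_eq_neg (funext fun x ↦ antipodalAction_neg_one_smul 4 x) y v w

/-- The antipodal maps are `C^∞` (tree). [folklore] -/
theorem contMDiff_antipodal : ∀ u : ℤˣ, ContMDiff (𝓡 4) (𝓡 4) ∞ (fun x : S4 ↦ u • x) :=
  contMDiff_antipodal_smul 4

/-- `ℝℙ⁴ = S⁴/±1` is a `C^∞` manifold (tree `QuotientManifold.isManifold`). [folklore] -/
theorem isManifold_rp4 : IsManifold (𝓡 4) ∞ RP4 :=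
  Literature.Geometry.Manifold.QuotientManifold.isManifold (I := 𝓡 4) (n := ∞) (G := ℤˣ)
    (M := S4) contMDiff_antipodal

attribute [local instance] isManifold_rp4

/-- Local notation: **the round metric of `ℝℙ⁴`** = the quotient of the round metric by the
antipodal isometries (tree `quotientMetric`, Lee 2018 Prop. 2.32). -/
local notation "gRP" => (QuotientMetric.quotientMetric (G := ℤˣ) (M := S4) (I := 𝓡 4)
  (roundMetric (n := 4) V5) contMDiff_antipodal roundMetric_antipodal)

/-- Levi-Civita connection of the round `ℝℙ⁴` metric (tree theorem `hasLeviCivita`). [folklore] -/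
theorem hasLeviCivita_gRP : (gRP).HasLeviCivita := (gRP).hasLeviCivita

attribute [local instance] hasLeviCivita_gRP

/-- The round `ℝℙ⁴` metric is Riemannian. [cite: Lee2018, Prop. 2.32] -/
theorem isRiemannian_gRP : (gRP).IsRiemannian :=
  QuotientMetric.isRiemannian_quotientMetric (G := ℤˣ) (M := S4) (I := 𝓡 4)
    (roundMetric (n := 4) V5) contMDiff_antipodal roundMetric_antipodal isRiemannian_roundMetric

/-- **The round `ℝℙ⁴` has constant sectional curvature `1`**: `mk^* ḡ = g_round`
(`comap_mk_quotientMetric`) and constant curvature descends along the surjective local isometry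
`mk : S⁴ → ℝℙ⁴`. [cite: Lee2018, Prop. 8.36] -/
theorem hasConstantSectionalCurvature_gRP : (gRP).HasConstantSectionalCurvature 1 := by
  refine hasConstantSectionalCurvature_of_comap_of_surjective (gRP) contMDiff_pullbackBilin_holds
    (QuotientMetric.contMDiff_mk_infty_add_one (G := ℤˣ) (M := S4) (I := 𝓡 4) contMDiff_antipodal)
    (QuotientMetric.injective_mfderiv_mk (G := ℤˣ) (M := S4) (I := 𝓡 4) contMDiff_antipodal) rfl
    Quotient.mk_surjective ?_
  rw [QuotientMetric.comap_mk_quotientMetric (G := ℤˣ) (M := S4) (I := 𝓡 4)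
    (roundMetric (n := 4) V5) contMDiff_antipodal roundMetric_antipodal]
  exact hasConstantSectionalCurvature_roundMetric (EuclideanSpace ℝ (Fin (4 + 1)))

/-- Hence `∫|W|² = 0` on the round `ℝℙ⁴`. [cite: Lee2018, Prop. 8.36] -/
theorem weylEnergy_gRP : (gRP).weylEnergy = 0 :=
  hasConstantSectionalCurvature_gRP.weylEnergy_eq_zero
    (by rw [finrank_euclideanSpace_fin]; norm_num)

/-- And `R ≡ 12` on the round `ℝℙ⁴` (`S = m(m-1)c`). [cite: Lee2018, Prop. 8.36] -/
theorem scalarCurvature_gRP (p : RP4) : (gRP).scalarCurvature p = 12 := by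
  classical
  obtain ⟨b, hb⟩ := (gRP).exists_basis_isOrthonormalFrame (x := p) (isRiemannian_gRP p)
    (finrank_euclideanSpace_fin (𝕜 := ℝ) (n := 4))
  rw [(hasConstantSectionalCurvature_gRP.with
    (gRP).isLeviCivita_leviCivita_holds).scalarCurvature_eq_of_basis b hb]
  norm_num

/-- **`ℝℙ⁴ ≇ S⁴`**: `S⁴` is simply connected (tree), `ℝℙ⁴` is not (tree, `π₁ = ℤ₂`).
[cite: HatcherAT2002, Example 1.43] -/
theorem not_diffeomorph_rp4 :
    ¬ Nonempty (RP4 ≃ₘ⟮𝓡 4, 𝓡 4⟯ Metric.sphere (0 : EuclideanSpace ℝ (Fin 5)) 1) := by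
  rintro ⟨e⟩
  haveI : SimplyConnectedSpace (Metric.sphere (0 : EuclideanSpace ℝ (Fin 5)) 1) :=
    simplyConnectedSpace_euclideanSphere (n := 4) (by norm_num)
  have hsc : SimplyConnectedSpace RP4 := e.toHomeomorph.toHomotopyEquiv.simplyConnectedSpace
  exact (isRealProjectiveSpace_realProjectiveSpace 4).not_simplyConnectedSpace (by norm_num) hsc

/-- `S⁴` is connected. [folklore] -/
theorem connectedSpace_sphereFour : ConnectedSpace S4 := by
  refine isConnected_iff_connectedSpace.mp (isConnected_sphere ?_ (0 : V5) zero_le_one)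
  rw [← Module.finrank_eq_rank, finrank_euclideanSpace_fin]
  norm_num

/-- **Simple connectivity is load-bearing for `ChangGurskyYang`**, even weakened to connectedness:
the crux with `[SimplyConnectedSpace M]` replaced by `[ConnectedSpace M]` is FALSE — the round
`ℝℙ⁴` is closed, connected, Riemannian with `R = 12 > 0` and `∫|W|² = 0 < 32π²`, and is not
diffeomorphic to `S⁴`. (CGY's Theorem A itself concludes "`S⁴` or `ℝP⁴`"; `π₁ = 1` is what removes
the second alternative.) [cite: ChangGurskyYang2003, Thm. A] -/
theorem changGurskyYang_false_without_simplyConnected :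
    ¬ (∀ (M : Type) [TopologicalSpace M] [T2Space M] [SecondCountableTopology M]
        [ChartedSpace (EuclideanSpace ℝ (Fin 4)) M] [IsManifold (𝓡 4) ∞ M] [CompactSpace M]
        [ConnectedSpace M],
        (∃ g : PseudoRiemannianMetric (𝓡 4) ∞ (EuclideanSpace ℝ (Fin 4)) (TangentSpace (𝓡 4) : M → Type _),
          ∃ _ : g.HasLeviCivita, g.IsRiemannian ∧ (∀ x, 0 < g.scalarCurvature x) ∧
            g.weylEnergy < ENNReal.ofReal (32 * Real.pi ^ 2)) →
        Nonempty (M ≃ₘ⟮𝓡 4, 𝓡 4⟯ Metric.sphere (0 : EuclideanSpace ℝ (Fin 5)) 1)) := by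
  intro h
  haveI : ConnectedSpace S4 := connectedSpace_sphereFour
  haveI : SecondCountableTopology RP4 :=
    ContinuousConstSMul.secondCountableTopology (Γ := ℤˣ) (T := S4)
  refine not_diffeomorph_rp4 (h RP4 ⟨gRP, inferInstance, isRiemannian_gRP, fun p ↦ ?_, ?_⟩)
  · rw [scalarCurvature_gRP]; norm_num
  · rw [weylEnergy_gRP]; exact ENNReal.ofReal_pos.2 (by positivity)

end Summit.SmoothPoincare4.SmoothPoincare4.Theorems.ChangGurskyYang.Negative

end
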